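import Summits.ValiantsHypothesis.ValiantsHypothesis.Theorems.LacunarySymmetroidMatrixDescartesDoorA26WallBubblingClusterRungs

/-!
# Wall bubbling for `DoorA26` — (W-split) linking, rung 5: THE SCALE-RATIO LAW AND EXPONENTIAL DEADNESS RATES BETWEEN TWO CLUSTERS

HONEST FRAMING.  Chain lemmas for obligation (W) `stub_weylFaces` of `Cruxes/DoorA26/Lines/wall_bubbling.lean` (stmt-ValiantsHypothesis-19979
`DoorA26`; OPEN, typed, never asserted), W2 seat val-sym-door-p1 g15; named residual `NoTightChain26` («(W-split) multi-scale linking») of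
`Cruxes/DoorA26/Lines/wall_bubbling_ConfluentDoor.lean` rev 4/5.  QUANTITATIVE form of the two-scale monotonicity #18 / #24 `clusters_monotone`, in the
cluster currency of `confluentClusters` (#22): two clusters `c, c'` of one letter family at centres `s c k`, `s c' k` with `L_k = s c' k − s c k → +∞`,
Gram normalisations `μ_c, μ_{c'}` of the confluent frames of the recentred letters, limits `Γ_c, Γ_{c'}`.

* `transvection_subexp` — the transvection coefficient of the frame transport is SUB-EXPONENTIAL: `(1 + |dslope (y ↦ e^{yM}) 0 w_k|)² ≤ e^{η L_k}`
  eventually, for every `η > 0`, whenever `|M| = |L_k|` (`w_k → 0`).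
* **`scaleRatio_lower` / `scaleRatio_upper` — THE SCALE-RATIO LAW**: an entry `(p,q)` alive at `c` forces `e^{(δ0 p + δ0 q − η)L} μ_c ≤ μ_{c'}`, an entry
  `(p',q')` alive at `c'` forces `μ_{c'} ≤ e^{(δ0 p' + δ0 q' + η)L} μ_c` (eventually, every `η > 0`).  So `L⁻¹ log(μ_{c'}/μ_c)` is eventually squeezed
  between `max Λ_c − η` and `min Λ_{c'} + η`; for consecutive clusters of a TIGHT chain (#26/#28: `max Λ_c = min Λ_{c+1}` = the hinge value `h_c`) the
  normalisations grow EXACTLY like `e^{h_c L}` up to `e^{o(L)}`.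
* **`deadness_above` / `deadness_below` — EXPONENTIAL DEADNESS RATES**: at the earlier cluster every polar Gram entry of value `v` is
  `≤ e^{(v' − v + η)L} μ_c` for every value `v'` alive at the later cluster (entries ABOVE the later cluster's active values are exponentially dead at `c`,
  with rate at least the value gap), and symmetrically at the later cluster every entry of value `v'` is `≤ e^{(v' − v + η)L} μ_{c'}` for every value
  `v` alive at the earlier one.
= the ROOT-SIDE «coarse heights» of the line lead's linking programme (memo `wall_bubbling_M-sieve.md` §7, Lemma L); nothing here kills a chain.
No new definitions; nothing here bears on `DoorA26`, `MatrixDescartes` (stmt-ValiantsHypothesis-18050) or `VP ≠ VNP`; (W)/(W-split)/`ConfluentDoor26`/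
`NoTightChain26` OPEN.  [folklore] exponential vs polynomial growth.  [this work] the bookkeeping. -/

-- `Summit.ValiantsHypothesis.ValiantsHypothesis.…` repeats a component by the D-0017 layout
-- (single-conjunct summit), which the `dupNamespace` linter flags; the name is mandated.
set_option linter.dupNamespace false

namespace Summit.ValiantsHypothesis.ValiantsHypothesis.Theorems.LacunarySymmetroidMatrixDescartes.WallBubbling

open Finset Filter Topology
open Bubbling (polar)
open scoped BigOperators

/-! ## 1. The transvection coefficient is sub-exponential -/

/-- For `w_k → 0`, `L_k → +∞` and `η > 0`: eventually `(1 + |dslope (y ↦ e^{yM}) 0 w_k|)² ≤ e^{η L_k}` for every `M` with `|M| = |L_k|`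
(both transport directions `M = ±L_k`). [folklore] -/
theorem transvection_subexp (w L : ℕ → ℝ) (hw : Tendsto w atTop (𝓝 0)) (hL : Tendsto L atTop atTop) (η : ℝ) (hη : 0 < η) :
    ∀ᶠ k in atTop, ∀ M : ℝ, |M| = |L k| →
      (1 + |dslope (fun y : ℝ => Real.exp (y * M)) 0 (w k)|) ^ 2 ≤ Real.exp (η * L k) := by
  have hlim : Tendsto (fun k => (η / 2 * L k) ^ 2 * Real.exp (-(η / 2 * L k))) atTop (𝓝 0) :=
    (Real.tendsto_pow_mul_exp_neg_atTop_nhds_zero 2).comp (Filter.Tendsto.const_mul_atTop (by positivity) hL)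
  have e1 : ∀ᶠ k in atTop, (η / 2 * L k) ^ 2 * Real.exp (-(η / 2 * L k)) < (η / 2) ^ 2 / 4 :=
    hlim.eventually (gt_mem_nhds (by positivity))
  have e2 : ∀ᶠ k in atTop, 1 ≤ L k := hL.eventually_ge_atTop 1
  have e3 : ∀ᶠ k in atTop, |w k| ≤ η / 4 := by
    have : Tendsto (fun k => |w k|) atTop (𝓝 0) := by simpa using hw.abs
    exact (this.eventually (Iic_mem_nhds (by positivity))).mono fun k h => h
  filter_upwards [e1, e2, e3] with k h1 h2 h3 M hM
  have hL0 : 0 ≤ L k := le_trans zero_le_one h2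
  have hMabs : |M| = L k := by rw [hM, abs_of_nonneg hL0]
  -- `|Λ'| ≤ L e^{ηL/4}`
  have hΛ : |dslope (fun y : ℝ => Real.exp (y * M)) 0 (w k)| ≤ L k * Real.exp (η / 4 * L k) := by
    have hb := abs_dslope_exp_le M (w k)
    rw [hMabs] at hb
    exact hb.trans (mul_le_mul_of_nonneg_left (Real.exp_le_exp.mpr (mul_le_mul_of_nonneg_right h3 hL0)) hL0)
  -- `4 L² ≤ e^{ηL/2}`
  have hsq : 4 * (L k) ^ 2 ≤ Real.exp (η / 2 * L k) := by
    have hpos : 0 < Real.exp (-(η / 2 * L k)) := Real.exp_pos _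
    have h1' : (η / 2) ^ 2 * ((L k) ^ 2 * Real.exp (-(η / 2 * L k))) < (η / 2) ^ 2 / 4 := by
      have : (η / 2 * L k) ^ 2 * Real.exp (-(η / 2 * L k)) = (η / 2) ^ 2 * ((L k) ^ 2 * Real.exp (-(η / 2 * L k))) := by ring
      rw [← this]; exact h1
    have hη2 : 0 < (η / 2) ^ 2 := by positivity
    have h2' : (L k) ^ 2 * Real.exp (-(η / 2 * L k)) < 1 / 4 := by
      by_contra hge
      push Not at hge
      have := mul_le_mul_of_nonneg_left hge hη2.le
      linarith
    have h3' : (L k) ^ 2 * Real.exp (-(η / 2 * L k)) * Real.exp (η / 2 * L k) = (L k) ^ 2 := by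
      rw [mul_assoc, ← Real.exp_add, neg_add_cancel, Real.exp_zero, mul_one]
    have h4' := mul_lt_mul_of_pos_right h2' (Real.exp_pos (η / 2 * L k))
    rw [h3'] at h4'
    linarith
  -- combine
  have hX1 : 1 ≤ L k * Real.exp (η / 4 * L k) := by
    have : 1 ≤ Real.exp (η / 4 * L k) := Real.one_le_exp (by positivity)
    nlinarith
  calc (1 + |dslope (fun y : ℝ => Real.exp (y * M)) 0 (w k)|) ^ 2
      ≤ (2 * (L k * Real.exp (η / 4 * L k))) ^ 2 := by
        apply pow_le_pow_left₀ (by positivity)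
        linarith
    _ = 4 * (L k) ^ 2 * (Real.exp (η / 4 * L k) * Real.exp (η / 4 * L k)) := by ring
    _ = 4 * (L k) ^ 2 * Real.exp (η / 2 * L k) := by rw [← Real.exp_add]; ring_nf
    _ ≤ Real.exp (η / 2 * L k) * Real.exp (η / 2 * L k) := mul_le_mul_of_nonneg_right hsq (Real.exp_pos _).le
    _ = Real.exp (η * L k) := by rw [← Real.exp_add]; ring_nf

/-! ## 2. The scale-ratio law -/

/-- **SCALE-RATIO LAW, LOWER BOUND.**  Two clusters `c, c'` at centres `s c k`, `s c' k` with `s c' − s c → +∞` (cluster currency of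
`confluentClusters`): an entry `(p,q)` alive at the EARLIER cluster forces `e^{(δ0 p + δ0 q − η)(s c' − s c)}·μ_c ≤ μ_{c'}` eventually, for every `η > 0`.
[this work] -/
theorem scaleRatio_lower (δs : ℕ → Fin 6 → ℝ) (δ0 : Fin 6 → ℝ)
    (hδ : ∀ l, Tendsto (fun k => δs k l) atTop (𝓝 (δ0 l))) (h05 : δ0 5 = δ0 0)
    (U : ℕ → Fin 6 → Matrix (Fin 2) (Fin 2) ℝ) {C : ℕ} (s : Fin C → ℕ → ℝ)
    (μ : Fin C → ℕ → ℝ) (Γ : Fin C → Fin 6 → Fin 6 → ℝ) (hμ : ∀ c k, 0 < μ c k)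
    (hdom : ∀ c k a b, |polar
      (if a = 0 then Real.exp (δs k 0 * s c k) • U k 0 + Real.exp (δs k 5 * s c k) • U k 5
        else if a = 5 then (δs k 5 - δs k 0) • (Real.exp (δs k 5 * s c k) • U k 5) else Real.exp (δs k a * s c k) • U k a)
      (if b = 0 then Real.exp (δs k 0 * s c k) • U k 0 + Real.exp (δs k 5 * s c k) • U k 5
        else if b = 5 then (δs k 5 - δs k 0) • (Real.exp (δs k 5 * s c k) • U k 5) else Real.exp (δs k b * s c k) • U k b)| ≤ μ c k)
    (hΓ : ∀ c a b, Tendsto (fun k => polar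
      (if a = 0 then Real.exp (δs k 0 * s c k) • U k 0 + Real.exp (δs k 5 * s c k) • U k 5
        else if a = 5 then (δs k 5 - δs k 0) • (Real.exp (δs k 5 * s c k) • U k 5) else Real.exp (δs k a * s c k) • U k a)
      (if b = 0 then Real.exp (δs k 0 * s c k) • U k 0 + Real.exp (δs k 5 * s c k) • U k 5
        else if b = 5 then (δs k 5 - δs k 0) • (Real.exp (δs k 5 * s c k) • U k 5) else Real.exp (δs k b * s c k) • U k b) / μ c k)
      atTop (𝓝 (Γ c a b)))
    (c c' : Fin C) (hL : Tendsto (fun k => s c' k - s c k) atTop atTop)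
    (p q : Fin 6) (hpq : Γ c p q ≠ 0) (η : ℝ) (hη : 0 < η) :
    ∀ᶠ k in atTop, Real.exp ((δ0 p + δ0 q - η) * (s c' k - s c k)) * μ c k ≤ μ c' k := by
  set κ : ℝ := |Γ c p q| / 2 with hκ
  have hκpos : 0 < κ := by rw [hκ]; exact half_pos (abs_pos.mpr hpq)
  -- the entry is alive at `c`
  have e1 : ∀ᶠ k in atTop, κ * μ c k ≤ |polar
      (if p = 0 then Real.exp (δs k 0 * s c k) • U k 0 + Real.exp (δs k 5 * s c k) • U k 5
        else if p = 5 then (δs k 5 - δs k 0) • (Real.exp (δs k 5 * s c k) • U k 5) else Real.exp (δs k p * s c k) • U k p)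
      (if q = 0 then Real.exp (δs k 0 * s c k) • U k 0 + Real.exp (δs k 5 * s c k) • U k 5
        else if q = 5 then (δs k 5 - δs k 0) • (Real.exp (δs k 5 * s c k) • U k 5) else Real.exp (δs k q * s c k) • U k q)| := by
    have h := ((hΓ c p q).abs).eventually_const_lt (show κ < |Γ c p q| by rw [hκ]; linarith [abs_pos.mpr hpq])
    filter_upwards [h] with k hk
    rw [abs_div, abs_of_pos (hμ c k), lt_div_iff₀ (hμ c k)] at hk
    exact hk.le
  -- sub-exponential transvection, exponent convergence, `e^{−ηL/2} ≤ κ`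
  have hw0 : Tendsto (fun k => δs k 5 - δs k 0) atTop (𝓝 0) := by
    have := (hδ 5).sub (hδ 0); rw [h05, sub_self] at this; exact this
  have e2 := transvection_subexp (fun k => δs k 5 - δs k 0) (fun k => s c' k - s c k) hw0 hL (η / 2) (half_pos hη)
  have e3 : ∀ᶠ k in atTop, |(δs k p + δs k q) - (δ0 p + δ0 q)| ≤ η / 4 := by
    have h := ((hδ p).add (hδ q)).sub tendsto_const_nhds (b := δ0 p + δ0 q)
    rw [sub_self] at h
    have := h.abs
    rw [abs_zero] at this
    exact (this.eventually (Iic_mem_nhds (by positivity))).mono fun k hk => hk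
  have e4 : ∀ᶠ k in atTop, Real.exp (-(η / 4) * (s c' k - s c k)) ≤ κ := by
    have h : Tendsto (fun k => Real.exp (-(η / 4) * (s c' k - s c k))) atTop (𝓝 0) := by
      have := Real.tendsto_exp_neg_atTop_nhds_zero.comp (Filter.Tendsto.const_mul_atTop (show 0 < η / 4 by positivity) hL)
      refine this.congr' (Eventually.of_forall fun k => ?_)
      simp only [Function.comp]; ring_nf
    exact (h.eventually (Iic_mem_nhds hκpos)).mono fun k hk => hk
  have e5 : ∀ᶠ k in atTop, 0 ≤ s c' k - s c k := hL.eventually_ge_atTop 0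
  filter_upwards [e1, e2, e3, e4, e5] with k h1 h2 h3 h4 h5
  -- backward transfer: the entry at `c` is the transported entry at `c'`, shift `s c − s c'`
  have hshift : ∀ l, Real.exp (δs k l * (s c k - s c' k)) • (Real.exp (δs k l * s c' k) • U k l)
      = Real.exp (δs k l * s c k) • U k l := fun l => recenter_shift (δs k) (U k) (s c' k) (s c k) l
  have hbwd := polar_frameShift_le (δs k) (fun l => Real.exp (δs k l * s c' k) • U k l) (s c k - s c' k) (μ c' k) (hdom c' k) p q
  simp only [hshift] at hbwd
  have hT := h2 (s c k - s c' k) (by rw [show s c k - s c' k = -(s c' k - s c k) by ring, abs_neg])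
  -- chain the inequalities
  have hA : κ * μ c k ≤ Real.exp ((δs k p + δs k q) * (s c k - s c' k)) * Real.exp (η / 2 * (s c' k - s c k)) * μ c' k := by
    refine h1.trans (hbwd.trans ?_)
    refine mul_le_mul_of_nonneg_right ?_ (hμ c' k).le
    exact mul_le_mul_of_nonneg_left hT (Real.exp_pos _).le
  -- `e^{(v−η)L} μ ≤ μ'`: multiply `hA` by `e^{(v − η/4 ... )}` bookkeeping
  have hexp : Real.exp ((δ0 p + δ0 q - η) * (s c' k - s c k))
      ≤ Real.exp (-(η / 4) * (s c' k - s c k)) *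
        (Real.exp (-((δs k p + δs k q) * (s c k - s c' k))) * Real.exp (-(η / 2 * (s c' k - s c k)))) := by
    rw [← Real.exp_add, ← Real.exp_add]
    apply Real.exp_le_exp.mpr
    have hv : (δ0 p + δ0 q) * (s c' k - s c k) ≤ ((δs k p + δs k q) + η / 4) * (s c' k - s c k) := by
      apply mul_le_mul_of_nonneg_right _ h5
      have := (abs_le.mp h3).1; linarith
    nlinarith
  calc Real.exp ((δ0 p + δ0 q - η) * (s c' k - s c k)) * μ c k
      ≤ Real.exp (-(η / 4) * (s c' k - s c k)) *
          (Real.exp (-((δs k p + δs k q) * (s c k - s c' k))) * Real.exp (-(η / 2 * (s c' k - s c k)))) * μ c k :=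
        mul_le_mul_of_nonneg_right hexp (hμ c k).le
    _ ≤ κ * (Real.exp (-((δs k p + δs k q) * (s c k - s c' k))) * Real.exp (-(η / 2 * (s c' k - s c k)))) * μ c k := by
        have hpos : 0 ≤ (Real.exp (-((δs k p + δs k q) * (s c k - s c' k))) * Real.exp (-(η / 2 * (s c' k - s c k)))) * μ c k :=
          mul_nonneg (mul_nonneg (Real.exp_pos _).le (Real.exp_pos _).le) (hμ c k).le
        calc _ = Real.exp (-(η / 4) * (s c' k - s c k)) * ((Real.exp (-((δs k p + δs k q) * (s c k - s c' k))) *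
              Real.exp (-(η / 2 * (s c' k - s c k)))) * μ c k) := by ring
          _ ≤ κ * ((Real.exp (-((δs k p + δs k q) * (s c k - s c' k))) * Real.exp (-(η / 2 * (s c' k - s c k)))) * μ c k) :=
              mul_le_mul_of_nonneg_right h4 hpos
          _ = _ := by ring
    _ = (Real.exp (-((δs k p + δs k q) * (s c k - s c' k))) * Real.exp (-(η / 2 * (s c' k - s c k)))) * (κ * μ c k) := by ring
    _ ≤ (Real.exp (-((δs k p + δs k q) * (s c k - s c' k))) * Real.exp (-(η / 2 * (s c' k - s c k)))) *
          (Real.exp ((δs k p + δs k q) * (s c k - s c' k)) * Real.exp (η / 2 * (s c' k - s c k)) * μ c' k) :=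
        mul_le_mul_of_nonneg_left hA (mul_nonneg (Real.exp_pos _).le (Real.exp_pos _).le)
    _ = μ c' k := by
        have h1' : Real.exp (-((δs k p + δs k q) * (s c k - s c' k))) * Real.exp ((δs k p + δs k q) * (s c k - s c' k)) = 1 := by
          rw [← Real.exp_add, neg_add_cancel, Real.exp_zero]
        have h2' : Real.exp (-(η / 2 * (s c' k - s c k))) * Real.exp (η / 2 * (s c' k - s c k)) = 1 := by
          rw [← Real.exp_add, neg_add_cancel, Real.exp_zero]
        calc _ = (Real.exp (-((δs k p + δs k q) * (s c k - s c' k))) * Real.exp ((δs k p + δs k q) * (s c k - s c' k))) *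
              (Real.exp (-(η / 2 * (s c' k - s c k))) * Real.exp (η / 2 * (s c' k - s c k))) * μ c' k := by ring
          _ = μ c' k := by rw [h1', h2', one_mul, one_mul]

/-- **SCALE-RATIO LAW, UPPER BOUND.**  An entry `(p',q')` alive at the LATER cluster forces `μ_{c'} ≤ e^{(δ0 p' + δ0 q' + η)(s c' − s c)}·μ_c` eventually,
for every `η > 0`. [this work] -/
theorem scaleRatio_upper (δs : ℕ → Fin 6 → ℝ) (δ0 : Fin 6 → ℝ)
    (hδ : ∀ l, Tendsto (fun k => δs k l) atTop (𝓝 (δ0 l))) (h05 : δ0 5 = δ0 0)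
    (U : ℕ → Fin 6 → Matrix (Fin 2) (Fin 2) ℝ) {C : ℕ} (s : Fin C → ℕ → ℝ)
    (μ : Fin C → ℕ → ℝ) (Γ : Fin C → Fin 6 → Fin 6 → ℝ) (hμ : ∀ c k, 0 < μ c k)
    (hdom : ∀ c k a b, |polar
      (if a = 0 then Real.exp (δs k 0 * s c k) • U k 0 + Real.exp (δs k 5 * s c k) • U k 5
        else if a = 5 then (δs k 5 - δs k 0) • (Real.exp (δs k 5 * s c k) • U k 5) else Real.exp (δs k a * s c k) • U k a)
      (if b = 0 then Real.exp (δs k 0 * s c k) • U k 0 + Real.exp (δs k 5 * s c k) • U k 5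
        else if b = 5 then (δs k 5 - δs k 0) • (Real.exp (δs k 5 * s c k) • U k 5) else Real.exp (δs k b * s c k) • U k b)| ≤ μ c k)
    (hΓ : ∀ c a b, Tendsto (fun k => polar
      (if a = 0 then Real.exp (δs k 0 * s c k) • U k 0 + Real.exp (δs k 5 * s c k) • U k 5
        else if a = 5 then (δs k 5 - δs k 0) • (Real.exp (δs k 5 * s c k) • U k 5) else Real.exp (δs k a * s c k) • U k a)
      (if b = 0 then Real.exp (δs k 0 * s c k) • U k 0 + Real.exp (δs k 5 * s c k) • U k 5
        else if b = 5 then (δs k 5 - δs k 0) • (Real.exp (δs k 5 * s c k) • U k 5) else Real.exp (δs k b * s c k) • U k b) / μ c k)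
      atTop (𝓝 (Γ c a b)))
    (c c' : Fin C) (hL : Tendsto (fun k => s c' k - s c k) atTop atTop)
    (p' q' : Fin 6) (hp'q' : Γ c' p' q' ≠ 0) (η : ℝ) (hη : 0 < η) :
    ∀ᶠ k in atTop, μ c' k ≤ Real.exp ((δ0 p' + δ0 q' + η) * (s c' k - s c k)) * μ c k := by
  set κ : ℝ := |Γ c' p' q'| / 2 with hκ
  have hκpos : 0 < κ := by rw [hκ]; exact half_pos (abs_pos.mpr hp'q')
  have e1 : ∀ᶠ k in atTop, κ * μ c' k ≤ |polar
      (if p' = 0 then Real.exp (δs k 0 * s c' k) • U k 0 + Real.exp (δs k 5 * s c' k) • U k 5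
        else if p' = 5 then (δs k 5 - δs k 0) • (Real.exp (δs k 5 * s c' k) • U k 5) else Real.exp (δs k p' * s c' k) • U k p')
      (if q' = 0 then Real.exp (δs k 0 * s c' k) • U k 0 + Real.exp (δs k 5 * s c' k) • U k 5
        else if q' = 5 then (δs k 5 - δs k 0) • (Real.exp (δs k 5 * s c' k) • U k 5) else Real.exp (δs k q' * s c' k) • U k q')| := by
    have h := ((hΓ c' p' q').abs).eventually_const_lt (show κ < |Γ c' p' q'| by rw [hκ]; linarith [abs_pos.mpr hp'q'])
    filter_upwards [h] with k hk
    rw [abs_div, abs_of_pos (hμ c' k), lt_div_iff₀ (hμ c' k)] at hk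
    exact hk.le
  have hw0 : Tendsto (fun k => δs k 5 - δs k 0) atTop (𝓝 0) := by
    have := (hδ 5).sub (hδ 0); rw [h05, sub_self] at this; exact this
  have e2 := transvection_subexp (fun k => δs k 5 - δs k 0) (fun k => s c' k - s c k) hw0 hL (η / 2) (half_pos hη)
  have e3 : ∀ᶠ k in atTop, |(δs k p' + δs k q') - (δ0 p' + δ0 q')| ≤ η / 4 := by
    have h := ((hδ p').add (hδ q')).sub tendsto_const_nhds (b := δ0 p' + δ0 q')
    rw [sub_self] at h
    have := h.abs
    rw [abs_zero] at this
    exact (this.eventually (Iic_mem_nhds (by positivity))).mono fun k hk => hk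
  have e4 : ∀ᶠ k in atTop, Real.exp (-(η / 4) * (s c' k - s c k)) ≤ κ := by
    have h : Tendsto (fun k => Real.exp (-(η / 4) * (s c' k - s c k))) atTop (𝓝 0) := by
      have := Real.tendsto_exp_neg_atTop_nhds_zero.comp (Filter.Tendsto.const_mul_atTop (show 0 < η / 4 by positivity) hL)
      refine this.congr' (Eventually.of_forall fun k => ?_)
      simp only [Function.comp]; ring_nf
    exact (h.eventually (Iic_mem_nhds hκpos)).mono fun k hk => hk
  have e5 : ∀ᶠ k in atTop, 0 ≤ s c' k - s c k := hL.eventually_ge_atTop 0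
  filter_upwards [e1, e2, e3, e4, e5] with k h1 h2 h3 h4 h5
  -- forward transfer: the entry at `c'` is the transported entry at `c`, shift `s c' − s c`
  have hshift : ∀ l, Real.exp (δs k l * (s c' k - s c k)) • (Real.exp (δs k l * s c k) • U k l)
      = Real.exp (δs k l * s c' k) • U k l := fun l => recenter_shift (δs k) (U k) (s c k) (s c' k) l
  have hfwd := polar_frameShift_le (δs k) (fun l => Real.exp (δs k l * s c k) • U k l) (s c' k - s c k) (μ c k) (hdom c k) p' q'
  simp only [hshift] at hfwd
  have hT := h2 (s c' k - s c k) rfl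
  have hA : κ * μ c' k ≤ Real.exp ((δs k p' + δs k q') * (s c' k - s c k)) * Real.exp (η / 2 * (s c' k - s c k)) * μ c k := by
    refine h1.trans (hfwd.trans ?_)
    refine mul_le_mul_of_nonneg_right ?_ (hμ c k).le
    exact mul_le_mul_of_nonneg_left hT (Real.exp_pos _).le
  have hexp : Real.exp ((δs k p' + δs k q') * (s c' k - s c k)) * Real.exp (η / 2 * (s c' k - s c k))
      ≤ Real.exp (-(η / 4) * (s c' k - s c k)) * Real.exp ((δ0 p' + δ0 q' + η) * (s c' k - s c k)) := by
    rw [← Real.exp_add, ← Real.exp_add]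
    apply Real.exp_le_exp.mpr
    have hv : (δs k p' + δs k q') * (s c' k - s c k) ≤ ((δ0 p' + δ0 q') + η / 4) * (s c' k - s c k) := by
      apply mul_le_mul_of_nonneg_right _ h5
      have := (abs_le.mp h3).2; linarith
    nlinarith
  have hB : κ * μ c' k ≤ κ * (Real.exp ((δ0 p' + δ0 q' + η) * (s c' k - s c k)) * μ c k) := by
    calc κ * μ c' k ≤ Real.exp ((δs k p' + δs k q') * (s c' k - s c k)) * Real.exp (η / 2 * (s c' k - s c k)) * μ c k := hA
      _ ≤ Real.exp (-(η / 4) * (s c' k - s c k)) * Real.exp ((δ0 p' + δ0 q' + η) * (s c' k - s c k)) * μ c k :=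
          mul_le_mul_of_nonneg_right hexp (hμ c k).le
      _ ≤ κ * Real.exp ((δ0 p' + δ0 q' + η) * (s c' k - s c k)) * μ c k :=
          mul_le_mul_of_nonneg_right (mul_le_mul_of_nonneg_right h4 (Real.exp_pos _).le) (hμ c k).le
      _ = κ * (Real.exp ((δ0 p' + δ0 q' + η) * (s c' k - s c k)) * μ c k) := by ring
  exact le_of_mul_le_mul_left hB hκpos

/-! ## 3. Exponential deadness rates -/

/-- **EXPONENTIAL DEADNESS ABOVE.**  If `(p',q')` is alive at the LATER cluster `c'`, then at the EARLIER cluster every polar Gram entry `(p,q)` satisfies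
`|g^{(c)}_{pq}| ≤ e^{(δ0 p' + δ0 q' − δ0 p − δ0 q + η)(s c' − s c)}·μ_c` eventually: entries whose value exceeds an active value of the later cluster are
exponentially dead at the earlier one, with rate at least the value gap. [this work] -/
theorem deadness_above (δs : ℕ → Fin 6 → ℝ) (δ0 : Fin 6 → ℝ)
    (hδ : ∀ l, Tendsto (fun k => δs k l) atTop (𝓝 (δ0 l))) (h05 : δ0 5 = δ0 0)
    (U : ℕ → Fin 6 → Matrix (Fin 2) (Fin 2) ℝ) {C : ℕ} (s : Fin C → ℕ → ℝ)
    (μ : Fin C → ℕ → ℝ) (Γ : Fin C → Fin 6 → Fin 6 → ℝ) (hμ : ∀ c k, 0 < μ c k)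
    (hdom : ∀ c k a b, |polar
      (if a = 0 then Real.exp (δs k 0 * s c k) • U k 0 + Real.exp (δs k 5 * s c k) • U k 5
        else if a = 5 then (δs k 5 - δs k 0) • (Real.exp (δs k 5 * s c k) • U k 5) else Real.exp (δs k a * s c k) • U k a)
      (if b = 0 then Real.exp (δs k 0 * s c k) • U k 0 + Real.exp (δs k 5 * s c k) • U k 5
        else if b = 5 then (δs k 5 - δs k 0) • (Real.exp (δs k 5 * s c k) • U k 5) else Real.exp (δs k b * s c k) • U k b)| ≤ μ c k)
    (hΓ : ∀ c a b, Tendsto (fun k => polar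
      (if a = 0 then Real.exp (δs k 0 * s c k) • U k 0 + Real.exp (δs k 5 * s c k) • U k 5
        else if a = 5 then (δs k 5 - δs k 0) • (Real.exp (δs k 5 * s c k) • U k 5) else Real.exp (δs k a * s c k) • U k a)
      (if b = 0 then Real.exp (δs k 0 * s c k) • U k 0 + Real.exp (δs k 5 * s c k) • U k 5
        else if b = 5 then (δs k 5 - δs k 0) • (Real.exp (δs k 5 * s c k) • U k 5) else Real.exp (δs k b * s c k) • U k b) / μ c k)
      atTop (𝓝 (Γ c a b)))
    (c c' : Fin C) (hL : Tendsto (fun k => s c' k - s c k) atTop atTop)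
    (p' q' : Fin 6) (hp'q' : Γ c' p' q' ≠ 0) (p q : Fin 6) (η : ℝ) (hη : 0 < η) :
    ∀ᶠ k in atTop, |polar
      (if p = 0 then Real.exp (δs k 0 * s c k) • U k 0 + Real.exp (δs k 5 * s c k) • U k 5
        else if p = 5 then (δs k 5 - δs k 0) • (Real.exp (δs k 5 * s c k) • U k 5) else Real.exp (δs k p * s c k) • U k p)
      (if q = 0 then Real.exp (δs k 0 * s c k) • U k 0 + Real.exp (δs k 5 * s c k) • U k 5
        else if q = 5 then (δs k 5 - δs k 0) • (Real.exp (δs k 5 * s c k) • U k 5) else Real.exp (δs k q * s c k) • U k q)|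
      ≤ Real.exp ((δ0 p' + δ0 q' - (δ0 p + δ0 q) + η) * (s c' k - s c k)) * μ c k := by
  have hup := scaleRatio_upper δs δ0 hδ h05 U s μ Γ hμ hdom hΓ c c' hL p' q' hp'q' (η / 3) (by positivity)
  have hw0 : Tendsto (fun k => δs k 5 - δs k 0) atTop (𝓝 0) := by
    have := (hδ 5).sub (hδ 0); rw [h05, sub_self] at this; exact this
  have e2 := transvection_subexp (fun k => δs k 5 - δs k 0) (fun k => s c' k - s c k) hw0 hL (η / 3) (by positivity)
  have e3 : ∀ᶠ k in atTop, |(δs k p + δs k q) - (δ0 p + δ0 q)| ≤ η / 3 := by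
    have h := ((hδ p).add (hδ q)).sub tendsto_const_nhds (b := δ0 p + δ0 q)
    rw [sub_self] at h
    have := h.abs
    rw [abs_zero] at this
    exact (this.eventually (Iic_mem_nhds (by positivity))).mono fun k hk => hk
  have e5 : ∀ᶠ k in atTop, 0 ≤ s c' k - s c k := hL.eventually_ge_atTop 0
  filter_upwards [hup, e2, e3, e5] with k h1 h2 h3 h5
  have hshift : ∀ l, Real.exp (δs k l * (s c k - s c' k)) • (Real.exp (δs k l * s c' k) • U k l)
      = Real.exp (δs k l * s c k) • U k l := fun l => recenter_shift (δs k) (U k) (s c' k) (s c k) l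
  have hbwd := polar_frameShift_le (δs k) (fun l => Real.exp (δs k l * s c' k) • U k l) (s c k - s c' k) (μ c' k) (hdom c' k) p q
  simp only [hshift] at hbwd
  have hT := h2 (s c k - s c' k) (by rw [show s c k - s c' k = -(s c' k - s c k) by ring, abs_neg])
  refine hbwd.trans ?_
  have hexp : Real.exp ((δs k p + δs k q) * (s c k - s c' k)) * Real.exp (η / 3 * (s c' k - s c k)) *
        Real.exp ((δ0 p' + δ0 q' + η / 3) * (s c' k - s c k))
      ≤ Real.exp ((δ0 p' + δ0 q' - (δ0 p + δ0 q) + η) * (s c' k - s c k)) := by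
    rw [← Real.exp_add, ← Real.exp_add]
    apply Real.exp_le_exp.mpr
    have hv : -((δs k p + δs k q) * (s c' k - s c k)) ≤ (-(δ0 p + δ0 q) + η / 3) * (s c' k - s c k) := by
      have := (abs_le.mp h3).1
      nlinarith
    nlinarith
  calc Real.exp ((δs k p + δs k q) * (s c k - s c' k)) *
        (1 + |dslope (fun y : ℝ => Real.exp (y * (s c k - s c' k))) 0 (δs k 5 - δs k 0)|) ^ 2 * μ c' k
      ≤ Real.exp ((δs k p + δs k q) * (s c k - s c' k)) * Real.exp (η / 3 * (s c' k - s c k)) *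
          (Real.exp ((δ0 p' + δ0 q' + η / 3) * (s c' k - s c k)) * μ c k) := by
        refine mul_le_mul (mul_le_mul_of_nonneg_left hT (Real.exp_pos _).le) h1 (hμ c' k).le ?_
        exact mul_nonneg (Real.exp_pos _).le (Real.exp_pos _).le
    _ = (Real.exp ((δs k p + δs k q) * (s c k - s c' k)) * Real.exp (η / 3 * (s c' k - s c k)) *
          Real.exp ((δ0 p' + δ0 q' + η / 3) * (s c' k - s c k))) * μ c k := by ring
    _ ≤ Real.exp ((δ0 p' + δ0 q' - (δ0 p + δ0 q) + η) * (s c' k - s c k)) * μ c k :=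
        mul_le_mul_of_nonneg_right hexp (hμ c k).le

/-- **EXPONENTIAL DEADNESS BELOW.**  If `(p,q)` is alive at the EARLIER cluster `c`, then at the LATER cluster every polar Gram entry `(p',q')` satisfies
`|g^{(c')}_{p'q'}| ≤ e^{(δ0 p' + δ0 q' − δ0 p − δ0 q + η)(s c' − s c)}·μ_{c'}` eventually: entries whose value lies below an active value of the earlier
cluster are exponentially dead at the later one. [this work] -/
theorem deadness_below (δs : ℕ → Fin 6 → ℝ) (δ0 : Fin 6 → ℝ)
    (hδ : ∀ l, Tendsto (fun k => δs k l) atTop (𝓝 (δ0 l))) (h05 : δ0 5 = δ0 0)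
    (U : ℕ → Fin 6 → Matrix (Fin 2) (Fin 2) ℝ) {C : ℕ} (s : Fin C → ℕ → ℝ)
    (μ : Fin C → ℕ → ℝ) (Γ : Fin C → Fin 6 → Fin 6 → ℝ) (hμ : ∀ c k, 0 < μ c k)
    (hdom : ∀ c k a b, |polar
      (if a = 0 then Real.exp (δs k 0 * s c k) • U k 0 + Real.exp (δs k 5 * s c k) • U k 5
        else if a = 5 then (δs k 5 - δs k 0) • (Real.exp (δs k 5 * s c k) • U k 5) else Real.exp (δs k a * s c k) • U k a)
      (if b = 0 then Real.exp (δs k 0 * s c k) • U k 0 + Real.exp (δs k 5 * s c k) • U k 5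
        else if b = 5 then (δs k 5 - δs k 0) • (Real.exp (δs k 5 * s c k) • U k 5) else Real.exp (δs k b * s c k) • U k b)| ≤ μ c k)
    (hΓ : ∀ c a b, Tendsto (fun k => polar
      (if a = 0 then Real.exp (δs k 0 * s c k) • U k 0 + Real.exp (δs k 5 * s c k) • U k 5
        else if a = 5 then (δs k 5 - δs k 0) • (Real.exp (δs k 5 * s c k) • U k 5) else Real.exp (δs k a * s c k) • U k a)
      (if b = 0 then Real.exp (δs k 0 * s c k) • U k 0 + Real.exp (δs k 5 * s c k) • U k 5
        else if b = 5 then (δs k 5 - δs k 0) • (Real.exp (δs k 5 * s c k) • U k 5) else Real.exp (δs k b * s c k) • U k b) / μ c k)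
      atTop (𝓝 (Γ c a b)))
    (c c' : Fin C) (hL : Tendsto (fun k => s c' k - s c k) atTop atTop)
    (p q : Fin 6) (hpq : Γ c p q ≠ 0) (p' q' : Fin 6) (η : ℝ) (hη : 0 < η) :
    ∀ᶠ k in atTop, |polar
      (if p' = 0 then Real.exp (δs k 0 * s c' k) • U k 0 + Real.exp (δs k 5 * s c' k) • U k 5
        else if p' = 5 then (δs k 5 - δs k 0) • (Real.exp (δs k 5 * s c' k) • U k 5) else Real.exp (δs k p' * s c' k) • U k p')
      (if q' = 0 then Real.exp (δs k 0 * s c' k) • U k 0 + Real.exp (δs k 5 * s c' k) • U k 5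
        else if q' = 5 then (δs k 5 - δs k 0) • (Real.exp (δs k 5 * s c' k) • U k 5) else Real.exp (δs k q' * s c' k) • U k q')|
      ≤ Real.exp ((δ0 p' + δ0 q' - (δ0 p + δ0 q) + η) * (s c' k - s c k)) * μ c' k := by
  have hlow := scaleRatio_lower δs δ0 hδ h05 U s μ Γ hμ hdom hΓ c c' hL p q hpq (η / 3) (by positivity)
  have hw0 : Tendsto (fun k => δs k 5 - δs k 0) atTop (𝓝 0) := by
    have := (hδ 5).sub (hδ 0); rw [h05, sub_self] at this; exact this
  have e2 := transvection_subexp (fun k => δs k 5 - δs k 0) (fun k => s c' k - s c k) hw0 hL (η / 3) (by positivity)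
  have e3 : ∀ᶠ k in atTop, |(δs k p' + δs k q') - (δ0 p' + δ0 q')| ≤ η / 3 := by
    have h := ((hδ p').add (hδ q')).sub tendsto_const_nhds (b := δ0 p' + δ0 q')
    rw [sub_self] at h
    have := h.abs
    rw [abs_zero] at this
    exact (this.eventually (Iic_mem_nhds (by positivity))).mono fun k hk => hk
  have e5 : ∀ᶠ k in atTop, 0 ≤ s c' k - s c k := hL.eventually_ge_atTop 0
  filter_upwards [hlow, e2, e3, e5] with k h1 h2 h3 h5
  have hshift : ∀ l, Real.exp (δs k l * (s c' k - s c k)) • (Real.exp (δs k l * s c k) • U k l)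
      = Real.exp (δs k l * s c' k) • U k l := fun l => recenter_shift (δs k) (U k) (s c k) (s c' k) l
  have hfwd := polar_frameShift_le (δs k) (fun l => Real.exp (δs k l * s c k) • U k l) (s c' k - s c k) (μ c k) (hdom c k) p' q'
  simp only [hshift] at hfwd
  have hT := h2 (s c' k - s c k) rfl
  refine hfwd.trans ?_
  -- `μ_c ≤ e^{−(v − η/3)L} μ_{c'}` from the lower scale-ratio law
  have hμc : μ c k ≤ Real.exp (-((δ0 p + δ0 q - η / 3) * (s c' k - s c k))) * μ c' k := by
    have hpos : 0 < Real.exp ((δ0 p + δ0 q - η / 3) * (s c' k - s c k)) := Real.exp_pos _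
    have := mul_le_mul_of_nonneg_left h1 (Real.exp_pos (-((δ0 p + δ0 q - η / 3) * (s c' k - s c k)))).le
    rw [← mul_assoc, ← Real.exp_add, neg_add_cancel, Real.exp_zero, one_mul] at this
    exact this
  have hexp : Real.exp ((δs k p' + δs k q') * (s c' k - s c k)) * Real.exp (η / 3 * (s c' k - s c k)) *
        Real.exp (-((δ0 p + δ0 q - η / 3) * (s c' k - s c k)))
      ≤ Real.exp ((δ0 p' + δ0 q' - (δ0 p + δ0 q) + η) * (s c' k - s c k)) := by
    rw [← Real.exp_add, ← Real.exp_add]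
    apply Real.exp_le_exp.mpr
    have hv : (δs k p' + δs k q') * (s c' k - s c k) ≤ ((δ0 p' + δ0 q') + η / 3) * (s c' k - s c k) := by
      have := (abs_le.mp h3).2
      nlinarith
    nlinarith
  calc Real.exp ((δs k p' + δs k q') * (s c' k - s c k)) *
        (1 + |dslope (fun y : ℝ => Real.exp (y * (s c' k - s c k))) 0 (δs k 5 - δs k 0)|) ^ 2 * μ c k
      ≤ Real.exp ((δs k p' + δs k q') * (s c' k - s c k)) * Real.exp (η / 3 * (s c' k - s c k)) *
          (Real.exp (-((δ0 p + δ0 q - η / 3) * (s c' k - s c k))) * μ c' k) := by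
        refine mul_le_mul (mul_le_mul_of_nonneg_left hT (Real.exp_pos _).le) hμc (hμ c k).le ?_
        exact mul_nonneg (Real.exp_pos _).le (Real.exp_pos _).le
    _ = (Real.exp ((δs k p' + δs k q') * (s c' k - s c k)) * Real.exp (η / 3 * (s c' k - s c k)) *
          Real.exp (-((δ0 p + δ0 q - η / 3) * (s c' k - s c k)))) * μ c' k := by ring
    _ ≤ Real.exp ((δ0 p' + δ0 q' - (δ0 p + δ0 q) + η) * (s c' k - s c k)) * μ c' k :=
        mul_le_mul_of_nonneg_right hexp (hμ c' k).le

end Summit.ValiantsHypothesis.ValiantsHypothesis.Theorems.LacunarySymmetroidMatrixDescartes.WallBubbling
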